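import Mathlib.Analysis.SpecialFunctions.Pow.Real
import Mathlib.Analysis.PSeries
import Literature.MathematicalPhysics.StatisticalMechanics.BarlowStackingEnergy
import Literature.MathematicalPhysics.StatisticalMechanics.MuGroundStateConfiguration
import HarnessLib

/-!
# Quantitative decay of the Lennard-Jones layer sums: `|Φ_δ(k; a, h)| ≤ C |k|⁻⁴`

For the interaction `layerInteraction lennardJones a h δ k = ∑'_{(i,j) ∈ ℤ²} V_LJ ‖i u + j v + δ w + k h e₃‖`
of a particle with a full triangular layer at signed layer distance `k ≠ 0` (`BarlowStackingEnergy.lean`),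
we prove the quantitative decay, uniform on quadrants `a ≥ a₁ > 0`, `h ≥ h₁ > 0` and for the two
registries `δ ∈ {0, 1}`:

* `abs_layerInteraction_lennardJones_le` — `|Φ_δ(k; a, h)| ≤ C(a₁, h₁) · |k|⁻⁴`.

Ingredients (elementary): `‖layerVec‖² = a² q_δ(i,j) + k² h²` with the planar form
`q_δ(i,j) = (i + j/2 + δ/2)² + ¾ (j + δ/3)²` (`normSq_layerVec`); cumulative planar counts
`#{q_δ < m} ≤ 10 m` (`card_filter_planarForm_lt_le`); the majorant `|V(r)| ≤ (h₁⁻⁶/12 + 1/6) r⁻⁶`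
(`r ≥ h₁`); layer-cake summation against the counts (`sum_le_of_cumulative_count`); the telescoping
estimate `∑_{n ≥ 1} (α n + β)⁻³ ≤ 1/(α β²)`.  The `tsum` is bounded through its finite partial sums,
so no summability input is needed (a non-summable family has `layerInteraction = 0`).
-/

noncomputable section

open Finset

namespace Literature.MathematicalPhysics.StatisticalMechanics

/-! ## The telescoping estimate `∑_{n=1}^{T} (α n + β)⁻³ ≤ 1/(α β²)` -/

/-- One telescoping step: for `0 < α ≤ x`, `α / x³ ≤ 1/(x − α)² − 1/x²`. [folklore] -/
theorem div_cube_le_inv_sq_sub {α x : ℝ} (hα : 0 < α) (hx : α < x) :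
    α / x ^ 3 ≤ 1 / (x - α) ^ 2 - 1 / x ^ 2 := by
  have hxpos : 0 < x := hα.trans hx
  have hxa : 0 < x - α := sub_pos.2 hx
  -- `1/(x-α)² - 1/x² = α(2x-α)/(x²(x-α)²) ≥ α x /(x² x²) = α/x³`
  have e : 1 / (x - α) ^ 2 - 1 / x ^ 2 = α * (2 * x - α) / (x ^ 2 * (x - α) ^ 2) := by
    field_simp
    ring
  rw [e, div_le_div_iff₀ (by positivity) (by positivity)]
  -- α · (x²(x-α)²) ≤ α(2x-α) · x³
  have h1 : (x - α) ^ 2 ≤ x ^ 2 := by nlinarith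
  have h2 : x ≤ 2 * x - α := by linarith
  calc α * (x ^ 2 * (x - α) ^ 2) ≤ α * (x ^ 2 * x ^ 2) := by gcongr
    _ = α * x * x ^ 3 := by ring
    _ ≤ α * (2 * x - α) * x ^ 3 := by gcongr

/-- **`∑_{n=1}^{T} (α n + β)⁻³ ≤ 1/(α β²)`** for `α, β > 0` (telescoping). [folklore] -/
theorem sum_inv_cube_affine_le {α β : ℝ} (hα : 0 < α) (hβ : 0 < β) (T : ℕ) :
    ∑ n ∈ Finset.Icc 1 T, ((α * n + β) ^ 3)⁻¹ ≤ 1 / (α * β ^ 2) := by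
  have key : ∀ n : ℕ, 1 ≤ n → α * ((α * n + β) ^ 3)⁻¹ ≤
      1 / (α * (n - 1 : ℕ) + β) ^ 2 - 1 / (α * n + β) ^ 2 := by
    intro n hn
    have hx : α < α * n + β := by
      have : (1 : ℝ) ≤ n := by exact_mod_cast hn
      nlinarith
    have h := div_cube_le_inv_sq_sub hα hx
    rw [div_eq_mul_inv] at h
    have hcast : α * n + β - α = α * ((n - 1 : ℕ) : ℝ) + β := by
      rw [Nat.cast_sub hn]; push_cast; ring
    rwa [hcast] at h
  have htel : ∑ n ∈ Finset.Icc 1 T, (1 / (α * ((n - 1 : ℕ) : ℝ) + β) ^ 2 - 1 / (α * n + β) ^ 2) =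
      1 / β ^ 2 - 1 / (α * T + β) ^ 2 := by
    induction T with
    | zero => simp
    | succ T ih =>
      rw [Finset.sum_Icc_succ_top (by omega), ih]
      simp only [Nat.add_sub_cancel]
      push_cast
      ring
  have hsum : α * ∑ n ∈ Finset.Icc 1 T, ((α * n + β) ^ 3)⁻¹ ≤ 1 / β ^ 2 - 1 / (α * T + β) ^ 2 := by
    rw [Finset.mul_sum, ← htel]
    exact Finset.sum_le_sum fun n hn => key n (Finset.mem_Icc.1 hn).1
  have hpos : 0 ≤ 1 / (α * T + β) ^ 2 := by positivity
  rw [le_div_iff₀ (by positivity)]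
  calc (∑ n ∈ Finset.Icc 1 T, ((α * n + β) ^ 3)⁻¹) * (α * β ^ 2)
      = (α * ∑ n ∈ Finset.Icc 1 T, ((α * n + β) ^ 3)⁻¹) * β ^ 2 := by ring
    _ ≤ (1 / β ^ 2 - 1 / (α * T + β) ^ 2) * β ^ 2 :=
        mul_le_mul_of_nonneg_right hsum (by positivity)
    _ ≤ (1 / β ^ 2) * β ^ 2 := by gcongr; linarith
    _ = 1 := by field_simp

/-- `∑_{n=0}^{T} (α n + β)⁻³ ≤ β⁻³ + 1/(α β²)`. [folklore] -/
theorem sum_range_inv_cube_affine_le {α β : ℝ} (hα : 0 < α) (hβ : 0 < β) (T : ℕ) :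
    ∑ n ∈ Finset.range (T + 1), ((α * n + β) ^ 3)⁻¹ ≤ (β ^ 3)⁻¹ + 1 / (α * β ^ 2) := by
  rw [Finset.range_eq_Ico, Finset.sum_eq_sum_Ico_succ_bot (by omega)]
  simp only [Nat.cast_zero, mul_zero, zero_add]
  gcongr
  have : Finset.Ico 1 (T + 1) = Finset.Icc 1 T := by
    ext n; simp only [Finset.mem_Ico, Finset.mem_Icc]; omega
  rw [this]
  exact sum_inv_cube_affine_le hα hβ T

/-! ## Counting lattice points of the planar forms -/

/-- Membership: an integer `z` with `|z - c| < r` lies in `Icc ⌈c - r⌉ ⌊c + r⌋`. [folklore] -/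
theorem mem_Icc_ceil_floor {c r : ℝ} {z : ℤ} (hz : |(z : ℝ) - c| < r) :
    z ∈ Finset.Icc ⌈c - r⌉ ⌊c + r⌋ := by
  rw [abs_lt] at hz
  rw [Finset.mem_Icc, Int.ceil_le, Int.le_floor]
  constructor <;> linarith [hz.1, hz.2]

/-- **Cumulative planar count**: in any finite `F ⊆ ℤ²`, the points with
`(i + j/2 + δ/2)² + ¾ (j + δ/3)² < m` (`m ≥ 1`) number at most `10 m`. [folklore] -/
theorem card_filter_planarForm_lt_le (δ : ℤ) (F : Finset (ℤ × ℤ)) {m : ℝ} (hm : 1 ≤ m) :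
    ((F.filter fun ij : ℤ × ℤ =>
        ((ij.1 : ℝ) + ij.2 / 2 + δ / 2) ^ 2 + 3 / 4 * ((ij.2 : ℝ) + δ / 3) ^ 2 < m).card : ℝ)
      ≤ 10 * m := by
  classical
  -- integers within `r` of a real centre `c`: at most `2r + 1` of them
  have card_Icc_le : ∀ (c r : ℝ), 0 ≤ r → ((Finset.Icc ⌈c - r⌉ ⌊c + r⌋).card : ℝ) ≤ 2 * r + 1 := by
    intro c r hr
    rw [Int.card_Icc]
    have h1 : (⌊c + r⌋ : ℝ) ≤ c + r := Int.floor_le _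
    have h2 : c - r ≤ (⌈c - r⌉ : ℝ) := Int.le_ceil _
    rcases le_or_gt (⌊c + r⌋ + 1 - ⌈c - r⌉) 0 with h | h
    · rw [Int.toNat_of_nonpos h]; simp; linarith
    · rw [show (((⌊c + r⌋ + 1 - ⌈c - r⌉).toNat : ℕ) : ℝ) = ((⌊c + r⌋ + 1 - ⌈c - r⌉ : ℤ) : ℝ) by
        rw [← Int.cast_natCast, Int.toNat_of_nonneg h.le]]
      push_cast; linarith
  set r₁ : ℝ := Real.sqrt m with hr₁
  set r₂ : ℝ := 2 * Real.sqrt (m / 3) with hr₂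
  have hr₁0 : 0 ≤ r₁ := Real.sqrt_nonneg _
  have hr₂0 : 0 ≤ r₂ := by positivity
  -- the `j`-range and, for each `j`, the `i`-range
  set J : Finset ℤ := Finset.Icc ⌈-(δ : ℝ) / 3 - r₂⌉ ⌊-(δ : ℝ) / 3 + r₂⌋ with hJ
  set I : ℤ → Finset ℤ := fun j => Finset.Icc ⌈(-(j : ℝ) / 2 - δ / 2) - r₁⌉ ⌊(-(j : ℝ) / 2 - δ / 2) + r₁⌋
    with hI
  set G : Finset (ℤ × ℤ) := J.biUnion fun j => (I j).image fun i => (i, j) with hG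
  have hsub : (F.filter fun ij : ℤ × ℤ =>
      ((ij.1 : ℝ) + ij.2 / 2 + δ / 2) ^ 2 + 3 / 4 * ((ij.2 : ℝ) + δ / 3) ^ 2 < m) ⊆ G := by
    intro ij hij
    rw [Finset.mem_filter] at hij
    obtain ⟨-, hlt⟩ := hij
    have hX : |(ij.1 : ℝ) - (-(ij.2 : ℝ) / 2 - δ / 2)| < r₁ := by
      rw [show (ij.1 : ℝ) - (-(ij.2 : ℝ) / 2 - δ / 2) = ij.1 + ij.2 / 2 + δ / 2 by ring]
      refine abs_lt_of_sq_lt_sq ?_ hr₁0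
      rw [hr₁, Real.sq_sqrt (by linarith)]
      nlinarith [sq_nonneg ((ij.2 : ℝ) + δ / 3)]
    have hY : |(ij.2 : ℝ) - (-(δ : ℝ) / 3)| < r₂ := by
      rw [show (ij.2 : ℝ) - (-(δ : ℝ) / 3) = ij.2 + δ / 3 by ring]
      refine abs_lt_of_sq_lt_sq ?_ hr₂0
      rw [hr₂, mul_pow, Real.sq_sqrt (by positivity)]
      nlinarith [sq_nonneg ((ij.1 : ℝ) + ij.2 / 2 + δ / 2)]
    rw [hG, Finset.mem_biUnion]
    refine ⟨ij.2, mem_Icc_ceil_floor hY, Finset.mem_image.2 ⟨ij.1, mem_Icc_ceil_floor hX, rfl⟩⟩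
  have hcardG : (G.card : ℝ) ≤ (2 * r₂ + 1) * (2 * r₁ + 1) := by
    calc (G.card : ℝ) ≤ ∑ j ∈ J, (((I j).image fun i => (i, j)).card : ℝ) := by
          exact_mod_cast Finset.card_biUnion_le
      _ ≤ ∑ _j ∈ J, (2 * r₁ + 1) := by
          refine Finset.sum_le_sum fun j _ => ?_
          calc ((((I j).image fun i => (i, j)).card : ℕ) : ℝ) ≤ ((I j).card : ℝ) := by
                exact_mod_cast Finset.card_image_le
            _ ≤ 2 * r₁ + 1 := card_Icc_le _ _ hr₁0
      _ = J.card * (2 * r₁ + 1) := by rw [Finset.sum_const, nsmul_eq_mul]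
      _ ≤ (2 * r₂ + 1) * (2 * r₁ + 1) := by
          gcongr
          exact card_Icc_le _ _ hr₂0
  -- numerics: `(2 r₂ + 1)(2 r₁ + 1) ≤ 10 m` using `r₁ = √m ≤ m`, `r₂ = 2√(m/3)`, `m ≥ 1`
  have hsq1 : r₁ ^ 2 = m := Real.sq_sqrt (by linarith)
  have hsq2 : r₂ ^ 2 = 4 * (m / 3) := by rw [hr₂, mul_pow, Real.sq_sqrt (by positivity)]; ring
  have hr₁1 : 1 ≤ r₁ := by rw [hr₁]; exact Real.one_le_sqrt.2 hm
  have hr₁m : r₁ ≤ m := by nlinarith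
  have hr₂r₁ : r₂ ≤ 6 / 5 * r₁ := by nlinarith
  calc ((F.filter fun ij : ℤ × ℤ =>
        ((ij.1 : ℝ) + ij.2 / 2 + δ / 2) ^ 2 + 3 / 4 * ((ij.2 : ℝ) + δ / 3) ^ 2 < m).card : ℝ)
      ≤ G.card := by exact_mod_cast Finset.card_le_card hsub
    _ ≤ (2 * r₂ + 1) * (2 * r₁ + 1) := hcardG
    _ ≤ 10 * m := by nlinarith

/-! ## Layer-cake summation against cumulative counts -/

/-- Abel/layer-cake identity: `(T+1) f T + ∑_{m<T} (m+1)(f m − f (m+1)) = ∑_{n ≤ T} f n`. [folklore] -/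
theorem layerCake_identity (f : ℕ → ℝ) (T : ℕ) :
    (T + 1 : ℝ) * f T + ∑ m ∈ Finset.range T, ((m : ℝ) + 1) * (f m - f (m + 1)) =
      ∑ n ∈ Finset.range (T + 1), f n := by
  induction T with
  | zero => simp
  | succ T ih =>
    rw [Finset.sum_range_succ, Finset.sum_range_succ _ (T + 1), ← ih]
    push_cast
    ring

/-- **Layer-cake bound.** If every `x ∈ F` carries a level `t x ≤ T`, the cumulative level counts
are `#{x ∈ F : t x ≤ m} ≤ B (m + 1)`, and `f` is non-increasing with `f T ≥ 0`, then
`∑_{x ∈ F} f (t x) ≤ B ∑_{n ≤ T} f n`. [folklore] -/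
theorem sum_le_of_cumulative_count {ι : Type*} (F : Finset ι) (t : ι → ℕ) (T : ℕ)
    (htT : ∀ x ∈ F, t x ≤ T) {B : ℝ}
    (hcount : ∀ m : ℕ, m ≤ T → ((F.filter fun x => t x ≤ m).card : ℝ) ≤ B * (m + 1))
    (f : ℕ → ℝ) (hf : ∀ n, f (n + 1) ≤ f n) (hfT : 0 ≤ f T) :
    ∑ x ∈ F, f (t x) ≤ B * ∑ n ∈ Finset.range (T + 1), f n := by
  classical
  -- telescoping representation of `f (t x)`
  have htel : ∀ x ∈ F, f (t x) = f T + ∑ m ∈ Finset.range T,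
      (if t x ≤ m then f m - f (m + 1) else 0) := by
    intro x hx
    have htx := htT x hx
    have h1 : ∑ m ∈ Finset.range T, (if t x ≤ m then f m - f (m + 1) else 0) =
        ∑ m ∈ Finset.Ico (t x) T, (f m - f (m + 1)) := by
      rw [Finset.range_eq_Ico]
      rw [← Finset.sum_Ico_consecutive (fun m => if t x ≤ m then f m - f (m + 1) else 0)
        (Nat.zero_le (t x)) htx]
      have hz : ∑ m ∈ Finset.Ico 0 (t x), (if t x ≤ m then f m - f (m + 1) else 0) = 0 :=
        Finset.sum_eq_zero fun m hm => by
          rw [Finset.mem_Ico] at hm; rw [if_neg (by omega)]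
      rw [hz, zero_add]
      exact Finset.sum_congr rfl fun m hm => by
        rw [Finset.mem_Ico] at hm; rw [if_pos hm.1]
    have h2 : ∑ m ∈ Finset.Ico (t x) T, (f m - f (m + 1)) = f (t x) - f T := by
      rw [Finset.sum_Ico_eq_sum_range]
      have := Finset.sum_range_sub' (fun k => f (t x + k)) (T - t x)
      simp only [add_zero] at this
      rw [Nat.add_sub_cancel' htx] at this
      rw [← this]
      exact Finset.sum_congr rfl fun k _ => by rw [add_assoc]
    rw [h1, h2]; ring
  rw [Finset.sum_congr rfl htel, Finset.sum_add_distrib, Finset.sum_const, nsmul_eq_mul,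
    Finset.sum_comm]
  -- evaluate the inner sums as counts
  have hinner : ∀ m ∈ Finset.range T,
      ∑ x ∈ F, (if t x ≤ m then f m - f (m + 1) else 0) =
        ((F.filter fun x => t x ≤ m).card : ℝ) * (f m - f (m + 1)) := by
    intro m _
    rw [← Finset.sum_filter, Finset.sum_const, nsmul_eq_mul]
  rw [Finset.sum_congr rfl hinner]
  have hF : (F.card : ℝ) ≤ B * (T + 1) := by
    have := hcount T le_rfl
    rwa [Finset.filter_true_of_mem (fun x hx => htT x hx)] at this
  calc (F.card : ℝ) * f T + ∑ m ∈ Finset.range T, ((F.filter fun x => t x ≤ m).card : ℝ) * (f m - f (m + 1))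
      ≤ B * (T + 1) * f T + ∑ m ∈ Finset.range T, B * (m + 1) * (f m - f (m + 1)) := by
        gcongr with m hm
        · exact sub_nonneg.2 (hf m)
        · exact hcount m (Finset.mem_range.1 hm).le
    _ = B * ((T + 1 : ℝ) * f T + ∑ m ∈ Finset.range T, ((m : ℝ) + 1) * (f m - f (m + 1))) := by
        have e : ∑ m ∈ Finset.range T, B * (m + 1) * (f m - f (m + 1)) =
            B * ∑ m ∈ Finset.range T, ((m : ℝ) + 1) * (f m - f (m + 1)) := by
          rw [Finset.mul_sum]
          exact Finset.sum_congr rfl fun m _ => by ring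
        rw [e]; ring
    _ = B * ∑ n ∈ Finset.range (T + 1), f n := by rw [layerCake_identity]

/-! ## The decay estimate -/

/-- Squared norm of `layerVec`: `‖i u + j v + δ w + k h e₃‖² = a² q_δ(i,j) + (k h)²` with the planar
form `q_δ(i,j) = (i + j/2 + δ/2)² + ¾ (j + δ/3)²`. [folklore] -/
theorem normSq_layerVec (a h : ℝ) (δ k i j : ℤ) :
    ‖layerVec a h δ k i j‖ ^ 2 =
      a ^ 2 * (((i : ℝ) + j / 2 + δ / 2) ^ 2 + 3 / 4 * ((j : ℝ) + δ / 3) ^ 2) + (k * h) ^ 2 := by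
  rw [norm_layerVec, Real.sq_sqrt (by positivity)]
  have h3 : Real.sqrt 3 ^ 2 = 3 := Real.sq_sqrt (by norm_num)
  linear_combination (a ^ 2 * ((j : ℝ) + δ / 3) ^ 2 / 4) * h3

/-- **Finite partial sums of the layer sum are `O(|k|⁻⁴)`**, uniformly on the quadrant
`a ≥ a₁ > 0`, `h ≥ h₁ > 0` and in `δ ∈ ℤ`: for every finite `F ⊆ ℤ²`,
`∑_{(i,j) ∈ F} |V_LJ ‖layerVec a h δ k i j‖| ≤ C(a₁,h₁) |k|⁻⁴` (`k ≠ 0`), with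
`C = 10 (h₁⁻⁶/12 + 1/6) (h₁⁻⁶ + a₁⁻² h₁⁻⁴)`. [folklore] -/
theorem sum_abs_lennardJones_layerVec_le {a₁ h₁ : ℝ} (ha₁ : 0 < a₁) (hh₁ : 0 < h₁) {a h : ℝ}
    (ha : a₁ ≤ a) (hh : h₁ ≤ h) (δ : ℤ) {k : ℤ} (hk : k ≠ 0) (F : Finset (ℤ × ℤ)) :
    ∑ ij ∈ F, |lennardJones ‖layerVec a h δ k ij.1 ij.2‖| ≤
      10 * (h₁⁻¹ ^ 6 / 12 + 1 / 6) * (h₁⁻¹ ^ 6 + a₁⁻¹ ^ 2 * h₁⁻¹ ^ 4) * ((|k| : ℝ) ^ 4)⁻¹ := by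
  classical
  have ha0 : 0 < a := ha₁.trans_le ha
  have hh0 : 0 < h := hh₁.trans_le hh
  have hk1 : (1 : ℝ) ≤ |(k : ℝ)| := by
    rw [← Int.cast_abs]; exact_mod_cast Int.one_le_abs hk
  set M : ℝ := h₁⁻¹ ^ 6 / 12 + 1 / 6 with hM
  have hM0 : 0 ≤ M := by positivity
  -- the planar form and its floor level
  set Q : ℤ × ℤ → ℝ := fun ij =>
    ((ij.1 : ℝ) + ij.2 / 2 + δ / 2) ^ 2 + 3 / 4 * ((ij.2 : ℝ) + δ / 3) ^ 2 with hQ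
  have hQ0 : ∀ ij, 0 ≤ Q ij := fun ij => by positivity
  set c2 : ℝ := (k : ℝ) ^ 2 * h₁ ^ 2 with hc2
  have hc2pos : 0 < c2 := by
    have : (k : ℝ) ≠ 0 := by exact_mod_cast hk
    positivity
  set f : ℕ → ℝ := fun n => M * ((a₁ ^ 2 * n + c2) ^ 3)⁻¹ with hf
  have hf_anti : ∀ n, f (n + 1) ≤ f n := by
    intro n
    simp only [hf]
    gcongr
    · linarith
  have hf0 : ∀ n, 0 ≤ f n := fun n => by positivity
  set t : ℤ × ℤ → ℕ := fun ij => ⌊Q ij⌋₊ with ht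
  -- per-point bound `|V ‖v‖| ≤ f (t ij)`
  have hpt : ∀ ij : ℤ × ℤ, |lennardJones ‖layerVec a h δ k ij.1 ij.2‖| ≤ f (t ij) := by
    intro ij
    have hsq := normSq_layerVec a h δ k ij.1 ij.2
    have hkh : h₁ ^ 2 ≤ ((k : ℝ) * h) ^ 2 := by
      rw [mul_pow]
      calc h₁ ^ 2 = 1 * h₁ ^ 2 := by ring
        _ ≤ (k : ℝ) ^ 2 * h ^ 2 := by
          gcongr
          · nlinarith [sq_abs (k : ℝ)]
    have hnorm_ge : h₁ ≤ ‖layerVec a h δ k ij.1 ij.2‖ := by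
      refine le_of_sq_le_sq ?_ (norm_nonneg _)
      rw [hsq]; nlinarith [hQ0 ij, sq_nonneg a]
    have hV := abs_lennardJones_le_of_le hh₁ hnorm_ge
    refine hV.trans ?_
    simp only [hf, ← hM]
    gcongr
    -- `‖v‖⁻¹ ^ 6 ≤ ((a₁² ⌊Q⌋₊ + c2) ^ 3)⁻¹`
    have hD : a₁ ^ 2 * (t ij : ℝ) + c2 ≤ ‖layerVec a h δ k ij.1 ij.2‖ ^ 2 := by
      rw [hsq]
      have h1 : (t ij : ℝ) ≤ Q ij := Nat.floor_le (hQ0 ij)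
      have h2 : a₁ ^ 2 ≤ a ^ 2 := by gcongr
      have h3 : c2 ≤ ((k : ℝ) * h) ^ 2 := by
        rw [hc2, mul_pow]; gcongr
      have h4 : a₁ ^ 2 * (t ij : ℝ) ≤ a ^ 2 * Q ij :=
        mul_le_mul h2 h1 (Nat.cast_nonneg _) (sq_nonneg a)
      simp only [hQ] at h4
      linarith
    have hDpos : 0 < a₁ ^ 2 * (t ij : ℝ) + c2 := by positivity
    rw [show ‖layerVec a h δ k ij.1 ij.2‖⁻¹ ^ 6 = ((‖layerVec a h δ k ij.1 ij.2‖ ^ 2) ^ 3)⁻¹ by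
      rw [inv_pow, ← pow_mul]]
    exact inv_anti₀ (by positivity) (by gcongr)
  -- layer-cake summation
  set T : ℕ := F.sup t with hT
  have htT : ∀ ij ∈ F, t ij ≤ T := fun ij hij => Finset.le_sup hij
  have hcount : ∀ m : ℕ, m ≤ T → ((F.filter fun ij => t ij ≤ m).card : ℝ) ≤ 10 * (m + 1) := by
    intro m _
    have hsub : (F.filter fun ij => t ij ≤ m) ⊆ F.filter fun ij : ℤ × ℤ =>
        ((ij.1 : ℝ) + ij.2 / 2 + δ / 2) ^ 2 + 3 / 4 * ((ij.2 : ℝ) + δ / 3) ^ 2 < (m : ℝ) + 1 := by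
      intro ij hij
      rw [Finset.mem_filter] at hij ⊢
      refine ⟨hij.1, ?_⟩
      have h1 : Q ij < (t ij : ℝ) + 1 := Nat.lt_floor_add_one (Q ij)
      have h2 : (t ij : ℝ) ≤ m := by exact_mod_cast hij.2
      show Q ij < m + 1
      linarith
    calc ((F.filter fun ij => t ij ≤ m).card : ℝ) ≤ ((F.filter fun ij : ℤ × ℤ =>
          ((ij.1 : ℝ) + ij.2 / 2 + δ / 2) ^ 2 + 3 / 4 * ((ij.2 : ℝ) + δ / 3) ^ 2 < (m : ℝ) + 1).card
            : ℝ) := by exact_mod_cast Finset.card_le_card hsub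
      _ ≤ 10 * ((m : ℝ) + 1) := by
          have := card_filter_planarForm_lt_le δ F (m := (m : ℝ) + 1) (by linarith [m.cast_nonneg (α := ℝ)])
          exact_mod_cast this
  have hcake := sum_le_of_cumulative_count F t T htT hcount f hf_anti (hf0 T)
  -- the level sum `∑_{n ≤ T} f n ≤ M (c2⁻³ + 1/(a₁² c2²))`
  have hlevel : ∑ n ∈ Finset.range (T + 1), f n ≤ M * ((c2 ^ 3)⁻¹ + 1 / (a₁ ^ 2 * c2 ^ 2)) := by
    rw [← Finset.mul_sum]
    exact mul_le_mul_of_nonneg_left (sum_range_inv_cube_affine_le (by positivity) hc2pos T) hM0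
  -- `c2⁻³ + 1/(a₁² c2²) ≤ (h₁⁻⁶ + a₁⁻² h₁⁻⁴) |k|⁻⁴`
  have hk2 : (1 : ℝ) ≤ (k : ℝ) ^ 2 := by nlinarith [sq_abs (k : ℝ)]
  have hkabs4 : (|(k : ℝ)|) ^ 4 = ((k : ℝ) ^ 2) ^ 2 := by
    rw [show (4 : ℕ) = 2 * 2 by rfl, pow_mul, sq_abs]
  have hfin : (c2 ^ 3)⁻¹ + 1 / (a₁ ^ 2 * c2 ^ 2) ≤
      (h₁⁻¹ ^ 6 + a₁⁻¹ ^ 2 * h₁⁻¹ ^ 4) * ((|(k : ℝ)|) ^ 4)⁻¹ := by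
    rw [hkabs4, hc2]
    have hk2pos : (0 : ℝ) < (k : ℝ) ^ 2 := by linarith
    rw [add_mul]
    gcongr
    · -- `((k² h₁²)³)⁻¹ ≤ h₁⁻⁶ (k²)⁻²`
      rw [inv_pow, show ((k : ℝ) ^ 2 * h₁ ^ 2) ^ 3 = (k : ℝ) ^ 2 * (h₁ ^ 6 * ((k : ℝ) ^ 2) ^ 2) by ring,
        mul_inv, mul_inv]
      have : ((k : ℝ) ^ 2)⁻¹ ≤ 1 := inv_le_one_of_one_le₀ hk2
      calc ((k : ℝ) ^ 2)⁻¹ * ((h₁ ^ 6)⁻¹ * (((k : ℝ) ^ 2) ^ 2)⁻¹)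
          ≤ 1 * ((h₁ ^ 6)⁻¹ * (((k : ℝ) ^ 2) ^ 2)⁻¹) := by gcongr
        _ = (h₁ ^ 6)⁻¹ * (((k : ℝ) ^ 2) ^ 2)⁻¹ := one_mul _
    · rw [inv_pow, inv_pow,
        show a₁ ^ 2 * ((k : ℝ) ^ 2 * h₁ ^ 2) ^ 2 = a₁ ^ 2 * h₁ ^ 4 * ((k : ℝ) ^ 2) ^ 2 by ring,
        one_div, mul_inv, mul_inv]
  have hC0 : 0 ≤ 10 * M := by positivity
  calc ∑ ij ∈ F, |lennardJones ‖layerVec a h δ k ij.1 ij.2‖|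
      ≤ ∑ ij ∈ F, f (t ij) := Finset.sum_le_sum fun ij _ => hpt ij
    _ ≤ 10 * ∑ n ∈ Finset.range (T + 1), f n := hcake
    _ ≤ 10 * (M * ((c2 ^ 3)⁻¹ + 1 / (a₁ ^ 2 * c2 ^ 2))) := by gcongr
    _ ≤ 10 * (M * ((h₁⁻¹ ^ 6 + a₁⁻¹ ^ 2 * h₁⁻¹ ^ 4) * ((|(k : ℝ)|) ^ 4)⁻¹)) := by gcongr
    _ = 10 * (h₁⁻¹ ^ 6 / 12 + 1 / 6) * (h₁⁻¹ ^ 6 + a₁⁻¹ ^ 2 * h₁⁻¹ ^ 4) * ((|k| : ℝ) ^ 4)⁻¹ := by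
        ring

/-- **Quantitative decay of the Lennard-Jones layer sums**: uniformly on the quadrant
`a ≥ a₁ > 0`, `h ≥ h₁ > 0` and in the registry `δ ∈ ℤ`,
`|Φ_δ(k; a, h)| = |layerInteraction V_LJ a h δ k| ≤ C(a₁, h₁) · |k|⁻⁴` for `k ≠ 0`, with the explicit
`C = 10 (h₁⁻⁶/12 + 1/6)(h₁⁻⁶ + a₁⁻² h₁⁻⁴)`.  (A non-summable family has `tsum = 0`, so no
summability hypothesis is needed.) [folklore] -/
theorem abs_layerInteraction_lennardJones_le {a₁ h₁ : ℝ} (ha₁ : 0 < a₁) (hh₁ : 0 < h₁) {a h : ℝ}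
    (ha : a₁ ≤ a) (hh : h₁ ≤ h) (δ : ℤ) {k : ℤ} (hk : k ≠ 0) :
    |layerInteraction lennardJones a h δ k| ≤
      10 * (h₁⁻¹ ^ 6 / 12 + 1 / 6) * (h₁⁻¹ ^ 6 + a₁⁻¹ ^ 2 * h₁⁻¹ ^ 4) * ((|k| : ℝ) ^ 4)⁻¹ := by
  have hB := sum_abs_lennardJones_layerVec_le ha₁ hh₁ ha hh δ hk
  have hC0 : 0 ≤ 10 * (h₁⁻¹ ^ 6 / 12 + 1 / 6) * (h₁⁻¹ ^ 6 + a₁⁻¹ ^ 2 * h₁⁻¹ ^ 4) *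
      ((|k| : ℝ) ^ 4)⁻¹ := by positivity
  unfold layerInteraction
  by_cases hs : Summable fun ij : ℤ × ℤ => lennardJones ‖layerVec a h δ k ij.1 ij.2‖
  · have habs : Summable fun ij : ℤ × ℤ => |lennardJones ‖layerVec a h δ k ij.1 ij.2‖| := hs.abs
    calc |∑' ij : ℤ × ℤ, lennardJones ‖layerVec a h δ k ij.1 ij.2‖|
        ≤ ∑' ij : ℤ × ℤ, |lennardJones ‖layerVec a h δ k ij.1 ij.2‖| := by
          have := norm_tsum_le_tsum_norm (f := fun ij : ℤ × ℤ =>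
            lennardJones ‖layerVec a h δ k ij.1 ij.2‖) (by simpa only [Real.norm_eq_abs] using habs)
          simpa only [Real.norm_eq_abs] using this
      _ ≤ _ := habs.tsum_le_of_sum_le hB
  · rw [tsum_eq_zero_of_not_summable hs, abs_zero]
    exact hC0

end Literature.MathematicalPhysics.StatisticalMechanics

end
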